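import Literature.NumberTheory.DiophantineGeometry.AVIsogenyTateHomPositiveFormsProofs
import Literature.NumberTheory.DiophantineGeometry.AVIsogenyTateHomStepIIProofs
import Literature.AlgebraicGeometry.Motives.AbelianVarietyHomCurveForm
import Literature.AlgebraicGeometry.Motives.CurveThroughPoint
import Literature.AlgebraicGeometry.Motives.AbelianVarietySymmetricAmpleProofs
import Literature.AlgebraicGeometry.Motives.AbelianVarietyKerRankOfCube
import Literature.AlgebraicGeometry.Motives.AbelianVarietyKernelComponent
import Literature.AlgebraicGeometry.Motives.CyclesDimensionFunctionField
import HarnessLib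

/-!
# `Hom(A, B)` finitely generated (Mumford §19, Theorem 3) from the theorem of the cube alone

Ninth proof file for the named fact
`Literature.AlgebraicGeometry.Motives.AbelianVariety.module_finite_hom` of `AVIsogenyTate`
(`Hom(A, B)` is a finitely generated group; Mumford, *Abelian Varieties*, §19, Theorem 3; Milne 1986,
Theorem 12.5) — a second, independent route to Step I of the printed proof.

The sibling files reduce Theorem 3 to Step I (the saturation of a finitely generated `M ≤ Hom(A, B)`
lies in a finitely generated subgroup) plus the theorem of the cube
(`module_finite_hom_of_exists_fg_of_natCard_torsionPoints`, `AVIsogenyTateHomStepIIProofs`), and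
obtain Step I from Poincaré's complete reducibility theorem (§19 Thm. 1) and "simple ⇒ isogeny"
(`AVIsogenyTateHomCubeProofs`, `…KernelProofs`). Here Step I is proved **without Poincaré
reducibility and without simplicity**, from the theorem of the cube alone, by *positivity*:

* `exists_apply_ne_apply_top`, `exists_testCurve_apply_ne` — over `k = k̄`, a non-zero homomorphism
  `f : A → B` is non-constant on some *test curve* (`TestCurve A`: an integral proper curve
  `c : C → A`), by `Motives/CurveThroughPoint` and the faithfulness of `k`-points
  (`Motives/AlgPointsSeparate`);
* `exists_fg_of_theoremOfCube_of_isAlgClosed` — **Step I over `k̄`**: with `L = d • D` for a symmetric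
  ample `D` on `B` (`exists_isAmple_symmetric_of_cube`), the curve forms
  `N_{c,L}(f) = deg_C ((f ∘ c)^* L)` (`Motives/AbelianVarietyHomCurveForm`: biadditive polar form by
  the cubical structure, `2N = B(·,·)`, `N ≥ 0`, and `N(f) ≥ 1` when `f ∘ c` is not constant, the
  proper curve not fitting into an affine `B_s`) form a separating family of positive integral
  quadratic forms on `Hom(A, B)`, and such a family forces the saturation property
  (`exists_fg_of_isPositiveForm`, `AVIsogenyTateHomPositiveFormsProofs`, ending in the discreteness
  lemma `fg_of_norm` exactly as the printed proof);
* `module_finite_hom_of_theoremOfCube_of_isAlgClosed`, **`AbelianVariety.module_finite_hom_of_theoremOfCube`**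
  (any field, by `module_finite_hom_of_baseChange`) and `module_finite_hom_of_pseudoCoherent_general`.

So the named fact `module_finite_hom` — and with it `module_free_hom`, `finrank_hom_le`,
`faltingsTateMap_injective`, `finiteDimensional_endAlgebra` — rests in the tree on the theorem of the
cube only (`theoremOfCube_linEquiv`, itself reduced to `cechComplex_pseudoCoherent_general`); the
discharge `module_finite_hom_holds A B` will be the one-liner
`module_finite_hom_of_theoremOfCube theoremOfCube_linEquiv_holds A B`.

The positivity replacing Poincaré's theorem is that of the Rosati involution (Mumford §21 Thm. 1;
Milne 1986 Thm. 17.3: `Tr(f f†) = (2g/(D^g)) (D^{g-1} · f^*D) > 0`), localised to curves so that only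
degrees of divisors on curves (`Motives/CartierDivisorCurveDegree`), and no intersection theory or dual
abelian variety, are needed; for elliptic curves it is the positive definiteness of `deg` on
`Hom(E₁, E₂)` (Silverman III.6.3), which classically gives finite generation the same way.

## References

* [MumfordAV1970] D. Mumford, *Abelian Varieties*, TIFR Studies in Mathematics 5, OUP (1970; 2nd ed.
  1974): §19, Thm. 3 and its proof (pp. 176–178); §21, Thm. 1. Not held; architecture as in Milne 1986.
* [Milne1986AbelianVarieties] J. S. Milne, *Abelian Varieties*, in Cornell–Silverman (eds.),
  *Arithmetic Geometry*, Springer (1986): Thm. 12.5 with Lemmas 12.6–12.7 (PDF pp. 190–191), Thm. 17.3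
  (PDF p. 206) (held: `book:cornellnd-arithmetic-geometry`).
* [GortzWedhorn2023] U. Görtz, T. Wedhorn, *Algebraic Geometry II* (2023): Thm. 24.73 (p. 550),
  Prop. 27.167 (p. 877).

## Design

No named facts, no `_holds` (net debt 0); `TestCurve A` is a data-carrying structure indexing the
family of forms; the theorem of the cube enters as the explicit hypothesis
`hcube : theoremOfCube_linEquiv` exactly as in the sibling files.
-/

universe u

open CategoryTheory CategoryTheory.Limits AlgebraicGeometry Order

noncomputable section

namespace Literature.NumberTheory.DiophantineGeometry

section AbelianVariety
open Literature.AlgebraicGeometry.Motives (AbelianVariety theoremOfCube_linEquiv SchemeOver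
  ClosedSubvariety cechComplex_pseudoCoherent_general theoremOfCube_linEquiv_of_pseudoCoherent_general)
open Literature.AlgebraicGeometry.Motives.AbelianVariety
open scoped MonObj

variable {k : Type u} [Field k]

/-! ### Finite dimension; non-zero homomorphisms are non-constant -/

/-- An integral `k`-scheme locally of finite type has finite dimension `d = height η`. [folklore] -/
theorem exists_height_top_eq_natCast (X : SchemeOver k) [IsIntegral X.left] [LocallyOfFiniteType X.hom] :
    ∃ d : ℕ, height (⊤ : ↥X.left) = d := by
  obtain ⟨_, ⟨U, hU, rfl⟩, htop, -⟩ :=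
    X.left.isBasis_affineOpens.exists_subset_of_mem_open (Set.mem_univ (⊤ : ↥X.left)) isOpen_univ
  have hU : IsAffineOpen U := hU
  haveI : Nonempty U := ⟨⟨⊤, htop⟩⟩
  obtain ⟨alg, hft⟩ := Literature.AlgebraicGeometry.Motives.Scheme.exists_algebra_finiteType X.hom hU
  obtain ⟨d, hd⟩ := Literature.AlgebraicGeometry.Motives.exists_ringKrullDim_eq_natCast k Γ(X.left, U)
  refine ⟨d, ?_⟩
  have h := Literature.AlgebraicGeometry.Motives.height_top_eq_ringKrullDim X.hom hU
  rw [hd] at h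
  exact_mod_cast h

variable {A B : AbelianVariety k}

/-- **A non-zero homomorphism of abelian varieties over an algebraically closed field is not
constant** (as a map of underlying points: some point has an image different from the image of the
generic point). If all points had the same image, this image would be the origin (image of `e_A`), so
every `k`-point of `A` would be killed by `f` (`comp_eq_one_of_apply_mem`), and `k`-points separate
homomorphisms over `k = k̄` (`SchemeOver.hom_ext_of_forall_algPoints`). [folklore] -/
theorem exists_apply_ne_apply_top [IsAlgClosed k] {f : A ⟶ B} (hf : f ≠ 0) :
    ∃ x : ↥A.X.left, (Hom.toSchemeHom f) x ≠ (Hom.toSchemeHom f) ⊤ := by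
  by_contra h
  simp only [not_exists, not_not] at h
  have htop : (Hom.toSchemeHom f) ⊤ = origin B := by rw [← h (origin A)]; exact toSchemeHom_origin f
  apply hf
  haveI : IsReduced A.X.left := isReduced_left A
  have key : f.hom.hom.hom = (0 : A ⟶ B).hom.hom.hom := by
    refine SchemeOver.hom_ext_of_forall_algPoints (X := A.X) (Y := B.X) k fun P => ?_
    rw [hom_zero, Grp.Hom.hom_one, Mon.Hom.hom_one, MonObj.comp_one]
    refine comp_eq_one_of_apply_mem f P ?_
    rw [mem_kerSet_iff, h, htop]
  exact AbelianVariety.hom_ext _ _ key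

/-! ### Test curves and the curve forms -/

variable (A) in
/-- A **test curve** in `A`: an integral proper one-dimensional `k`-scheme `C` with a `k`-morphism
`c : C → A`. [folklore] -/
structure TestCurve where
  /-- The curve, as a `k`-scheme. -/
  C : SchemeOver k
  /-- The curve is integral. -/
  [isIntegral : IsIntegral C.left]
  /-- The curve is proper over `k`. -/
  [isProper : IsProper C.hom]
  /-- The curve is one-dimensional. -/
  height_top : height (⊤ : ↥C.left) = 1
  /-- The test morphism `C → A`. -/
  c : C ⟶ A.X

attribute [instance] TestCurve.isIntegral TestCurve.isProper

/-- **Every non-zero homomorphism is non-constant on some test curve** (over `k = k̄`): the map of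
points underlying `f ≠ 0` is not constant (`exists_apply_ne_apply_top`), so through a suitable closed
point passes an integral closed curve of `A` on which it is not constant
(`exists_closedSubvariety_dim_eq_one_apply_ne`, `Motives/CurveThroughPoint`). [folklore] -/
theorem exists_testCurve_apply_ne [IsAlgClosed k] {f : A ⟶ B} (hf : f ≠ 0) :
    ∃ (t : TestCurve A) (w : ↥t.C.left),
      (Hom.toSchemeHom f) (t.c.left w) ≠ (Hom.toSchemeHom f) (t.c.left ⊤) := by
  obtain ⟨x, hx⟩ := exists_apply_ne_apply_top hf
  obtain ⟨d, hd⟩ := exists_height_top_eq_natCast A.X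
  obtain ⟨W, w, hW1, hWne⟩ :=
    Literature.AlgebraicGeometry.Motives.exists_closedSubvariety_dim_eq_one_apply_ne A.X.hom hd
      (φ := fun a => (Hom.toSchemeHom f) a) (Hom.toSchemeHom f).continuous hx
  let C : SchemeOver k := Over.mk (W.ι ≫ A.X.hom)
  haveI : IsIntegral C.left := W.isIntegral
  haveI : IsProper C.hom := inferInstanceAs (IsProper (W.ι ≫ A.X.hom))
  have hC : height (⊤ : ↥C.left) = 1 := by
    change height (⊤ : ↥W.carrier) = 1
    rw [← ClosedSubvariety.dim_eq_height_top, hW1]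
  refine ⟨⟨C, hC, Over.homMk W.ι rfl⟩, w, ?_⟩
  exact hWne

/-! ### Step I over an algebraically closed field; Theorem 3 from the theorem of the cube -/

/-- **Step I of Mumford's proof of §19 Thm. 3 without Poincaré reducibility, over `k = k̄`.** Granted
the Theorem of the Cube (`theoremOfCube_linEquiv`, Görtz–Wedhorn II Thm. 24.73), the saturation of
every finitely generated subgroup of `Hom(A, B)` lies in a finitely generated subgroup. Proof: `B`
carries a symmetric ample divisor `D` (`exists_isAmple_symmetric_of_cube`), and `L = d • D` is
symmetric and generated by affine sections; for every test curve `c : C → A` the curve form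
`N_{c,L}(f) = deg_C ((f ∘ c)^* L)` is a positive form on `Hom(A, B)` (biadditive polar form by the
cubical structure, `2N = B(·,·)` by symmetry, `N ≥ 0` — `Motives/AbelianVarietyHomCurveForm`), and the
family of all curve forms separates: `f ≠ 0` is non-constant on some test curve
(`exists_testCurve_apply_ne`), where `N_{c,L}(f) ≥ 1`. Conclude by `exists_fg_of_isPositiveForm`.
(In the printed proofs — Mumford §19, Milne 1986 Lemma 12.7 — the discreteness comes instead from
`deg ≥ 1` on `End(X) ∖ 0` for `X` simple, after reduction to simple factors by Poincaré's complete
reducibility theorem; the positivity used here is that of Mumford §21 Thm. 1 / Milne Thm. 17.3,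
localised to curves.) [cite: MumfordAV1970, §19 Thm. 3 (proof, first step)] -/
theorem exists_fg_of_theoremOfCube_of_isAlgClosed [IsAlgClosed k] (hcube : theoremOfCube_linEquiv.{u})
    (M : Submodule ℤ (A ⟶ B)) (hM : M.FG) :
    ∃ S : Submodule ℤ (A ⟶ B), S.FG ∧ ∀ φ : A ⟶ B, (∃ n : ℤ, n ≠ 0 ∧ n • φ ∈ M) → φ ∈ S := by
  -- a symmetric divisor on `B` generated by affine sections
  obtain ⟨D, hDamp, hDsym⟩ := exists_isAmple_symmetric_of_cube (A := B) hcube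
  obtain ⟨d, -, hgen⟩ := hDamp.exists_forall_mem_nonvanishing
  have hsym : ((d • D).pullback (Hom.toSchemeHom (-𝟙 B))).LinEquiv (d • D) := by
    rw [Literature.AlgebraicGeometry.Motives.CartierDivisor.pullback_smul]; exact hDsym.smul d
  have hcubeB : B.cubicalStructure_linEquiv := B.cubicalStructure_linEquiv_of_theoremOfCube hcube
  have hgen' : ∀ b : ↥B.X.left, ∃ s : B.X.left.functionField,
      (d • D).IsSection s ∧ b ∈ (d • D).nonvanishing s := fun b => by
    obtain ⟨s, h1, h2, -⟩ := hgen b; exact ⟨s, h1, h2⟩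
  -- the family of curve forms, indexed by the test curves in `A`
  have hNB : ∀ t : TestCurve A, IsPositiveForm (curveForm (d • D) t.C t.c)
      (curvePairing (d • D) t.c t.height_top hcubeB) := fun t =>
    { two_mul_eq := fun f => two_mul_curveForm (d • D) t.c t.height_top hcubeB hsym f
      symm := fun f g => curvePairing_comm (d • D) t.c t.height_top hcubeB f g
      nonneg := fun f => curveForm_nonneg (d • D) t.c t.height_top hgen' f }
  have hsep : ∀ f : A ⟶ B, f ≠ 0 → ∃ t : TestCurve A, 1 ≤ curveForm (d • D) t.C t.c f :=
    fun f hf => by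
      obtain ⟨t, w, hw⟩ := exists_testCurve_apply_ne hf
      exact ⟨t, one_le_curveForm (d • D) t.c t.height_top hgen f hw⟩
  exact exists_fg_of_isPositiveForm hNB hsep M hM

/-- **Mumford §19, Theorem 3 (`Hom(A, B)` is finitely generated) over an algebraically closed field,
from the Theorem of the Cube alone**: Step I is `exists_fg_of_theoremOfCube_of_isAlgClosed`, Steps
II–III are `module_finite_hom_of_exists_fg_of_natCard_torsionPoints` (`AVIsogenyTateHomStepIIProofs`)
with the torsion counts `#A[n](k̄) = n^{2 dim A}` derived from the cube
(`natCard_torsionPoints_of_isAlgClosed_of_theoremOfCube_linEquiv`).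
[cite: MumfordAV1970, §19 Thm. 3 (pp. 176–178)] -/
theorem module_finite_hom_of_theoremOfCube_of_isAlgClosed [IsAlgClosed k]
    (hcube : theoremOfCube_linEquiv.{u}) (A B : AbelianVariety k) : module_finite_hom A B :=
  module_finite_hom_of_exists_fg_of_natCard_torsionPoints A B
    (exists_fg_of_theoremOfCube_of_isAlgClosed hcube)
    (natCard_torsionPoints_of_isAlgClosed_of_theoremOfCube_linEquiv (A := A) (AlgebraicClosure k) hcube)
    (natCard_torsionPoints_of_isAlgClosed_of_theoremOfCube_linEquiv (A := B) (AlgebraicClosure k) hcube)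

/-- **Mumford §19, Theorem 3 over an arbitrary field from the Theorem of the Cube alone** — no
Poincaré reducibility, no simplicity: `Hom_K(A, B) ↪ Hom_K̄(A_K̄, B_K̄)`
(`module_finite_hom_of_baseChange`; Milne 1986, Thm. 12.5 is stated over any field) and
`module_finite_hom_of_theoremOfCube_of_isAlgClosed`. So the named fact `module_finite_hom` (and with it
`module_free_hom`, `finrank_hom_le`, `faltingsTateMap_injective`, `finiteDimensional_endAlgebra`, all
reduced to it in the sibling proof files) rests on the theorem of the cube only: the discharge
`module_finite_hom_holds A B` is `module_finite_hom_of_theoremOfCube theoremOfCube_linEquiv_holds A B`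
once Görtz–Wedhorn II Thm. 24.73 is discharged. [cite: MumfordAV1970, §19 Thm. 3 (pp. 176–178)]
[cite: Milne1986AbelianVarieties, Thm. 12.5 (PDF p. 190)] -/
theorem _root_.Literature.AlgebraicGeometry.Motives.AbelianVariety.module_finite_hom_of_theoremOfCube
    (hcube : theoremOfCube_linEquiv.{u}) (A B : AbelianVariety k) : module_finite_hom A B :=
  module_finite_hom_of_baseChange (A := A) (B := B) (AlgebraicClosure k)
    (module_finite_hom_of_theoremOfCube_of_isAlgClosed hcube _ _)

/-- **`Hom(A, B)` finitely generated from the pseudo-coherence of the Čech complex** — the current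
single unproved input in the tree (`cechComplex_pseudoCoherent_general`, Görtz–Wedhorn II
Thm. 23.133 / Cor. 23.135, from which the Theorem of the Cube is
`theoremOfCube_linEquiv_of_pseudoCoherent_general`). [cite: GortzWedhorn2023, Thm. 24.73 (p. 550)] -/
theorem _root_.Literature.AlgebraicGeometry.Motives.AbelianVariety.module_finite_hom_of_pseudoCoherent_general
    (h : cechComplex_pseudoCoherent_general.{u}) (A B : AbelianVariety k) : module_finite_hom A B :=
  module_finite_hom_of_theoremOfCube (theoremOfCube_linEquiv_of_pseudoCoherent_general h) A B

end AbelianVariety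

end Literature.NumberTheory.DiophantineGeometry
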